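import Literature.NumberTheory.LFunctions.Zhang2022.RepairFormulaIIBlock
import Literature.NumberTheory.LFunctions.Zhang2022.RepairFormReflection

/-!
# Zhang (2022), repair rung F-S1R, K-S2: the cross slot `P(u,v)` of the main-term form splits as
# (formula-II boundary block) + (window form) — generic profiles

Y. Zhang, *Discrete mean estimates and the Landau–Siegel zero*, arXiv:2211.02515v1 (2022)
[Zhang2022LandauSiegel] — an unrefereed manuscript under adjudication; nothing here is a claim about
its Theorems 1–2. The class functional of record for the `𝔠₃` slot (cell ruling R3 (D2a)) is the polar
value `P(g₁, R̃g₂)` of the tree's main-term form (`MainTermFormCauchySchwarz.mainTermFormPolar`) on the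
`H₁`-profile `u = g₁` (vanishing at `y = 1`) and the reflected `H₂`-profile `v = R̃g₂` (vanishing at
`y = 0`). This file proves the profile-generic identity behind the audit dictionary's "formula II +
§12 overhang" description of that slot (`pub-zhang/STRUCTURE.md` §§3–4, `repair/theory/KS2-DERIVATION.md`):

for `u, v` continuous on `[0,1]` with `u(1) = 0`, `v(0) = 0`,

`P(u,v) = F₀(u(0), conj v(1); ∫u, conj ∫v) + W(u,v)`,

`F₀(α, β; I, J) = −8i αβ − 12π(αJ + Iβ) + 24π²i IJ` (`RepairFormulaIIBlock.F0part` is `F₀` at the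
design data `(a₀, b₀; I_a, I_b)`) and

`W(u,v) = (8/π)⟨u′,v′⟩ + 88π⟨u,v⟩ − 24i(⟨u′,v⟩ − ⟨u,v′⟩) − 48π²i⟨u, S_v⟩`, `⟨a,b⟩ = ∫₀¹ a b̄`,
`S_v(x) = ∫₀ˣ v` — a form whose four integrands all carry a factor `u·` or `u′·` against `v̄`, `v̄′`
or `S̄_v`, hence live on `supp u ∩ {S_v ≠ 0 or v ≠ 0}`: for the design (`supp g₁ = [0,ν₁]`,
`supp R̃g₂ = [1−ν₂,1] ∪ [1−ν₃,1]`) the WINDOWS `[1−ν₂, ν₁] ∪ [1−ν₃, ν₁]` of lengths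
`L₇ = ν₁+ν₂−1`, `L₆ = ν₁+ν₃−1` (`0.004`, `0.002` in print) — exactly the ranges of (12.12)–(12.17),
which the manuscript evaluates after linearising (`e₁* + 2e₂*`).

* `F0gen`, `windowForm`; `F0gen_design : F0gen (a0T θ) (b0T θ) (IaT θ) (IbT θ) = F0part θ` (`rfl`-level);
* `integral_mul_conj_primitive_add` — the one integration by parts used:
  `∫₀¹ u·conj S_v + ∫₀¹ S_u·conj v = (∫₀¹u)·conj(∫₀¹v)`;
* **`mainTermFormPolar_eq_F0gen_add_windowForm`** — the identity above;
* `mainTermFormPolar_refl_eq` — the same with `v = R̃g`: `conj v(1) = g(0)`, `conj ∫v = ∫g`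
  (`RepairFormReflection.reflProfile_one`, `integral_reflProfile_one`), i.e.
  `P(u, R̃g) = F₀(u(0), g(0); ∫u, ∫g) + W(u, R̃g)` for `u(1) = 0 = g(1)`.

The design instance (`u = h1Profile θ`, `g = h2Profile θ` of the pair-block dictionary) is the companion
`RepairFrakc3S`. Calculus/algebra only; no `Prop` facts.
-/

noncomputable section

open Complex Real ComplexConjugate Set MeasureTheory intervalIntegral

namespace Literature.NumberTheory.LFunctions.Zhang2022

namespace Repair

/-! ### The two pieces -/

/-- The formula-II boundary block as a function of the data `(α, β; I, J) = (u(0), conj v(1); ∫u, conj ∫v)`: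
`F₀ = −8iαβ − 12π(αJ + Iβ) + 24π²i IJ`. [cite: Zhang2022LandauSiegel, §18 (18.1), Lemma 15.1, (17.4)] -/
def F0gen (α β Iu J : ℂ) : ℂ :=
  -8 * I * (α * β) - 12 * π * (α * J + Iu * β) + 24 * π ^ 2 * I * (Iu * J)

/-- At the design data `F₀` is `RepairFormulaIIBlock.F0part`. [cite: Zhang2022LandauSiegel, §18 (18.1)] -/
theorem F0gen_design (θ : Theta) : F0gen (a0T θ) (b0T θ) (IaT θ) (IbT θ) = F0part θ := rfl

/-- The WINDOW form `W(u,v) = (8/π)⟨u′,v′⟩ + 88π⟨u,v⟩ − 24i(⟨u′,v⟩ − ⟨u,v′⟩) − 48π²i⟨u,S_v⟩`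
(the part of the polar form carried by local products of the two profiles).
[cite: Zhang2022LandauSiegel, §12 (12.12)–(12.17); §18 (18.1)] -/
def windowForm (u u' v v' : ℝ → ℂ) : ℂ :=
  ((8 / π : ℝ) : ℂ) * (∫ x in (0:ℝ)..1, u' x * conj (v' x))
    + ((88 * π : ℝ) : ℂ) * (∫ x in (0:ℝ)..1, u x * conj (v x))
    - 24 * I * ((∫ x in (0:ℝ)..1, u' x * conj (v x)) - (∫ x in (0:ℝ)..1, u x * conj (v' x)))
    - ((48 * π ^ 2 : ℝ) : ℂ) * I * (∫ x in (0:ℝ)..1, u x * conj (∫ t in (0:ℝ)..x, v t))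

/-! ### Plumbing -/

/-- `conj` commutes with the interval integral (plumbing). [folklore] -/
private theorem conj_intervalIntegral' (f : ℝ → ℂ) (a b : ℝ) :
    conj (∫ x in a..b, f x) = ∫ x in a..b, conj (f x) := by
  simp only [intervalIntegral, map_sub, integral_conj]

/-- `conj ∫₀¹ u v̄ = ∫₀¹ v ū` (plumbing). [folklore] -/
private theorem conj_integral_mul_conj' (u v : ℝ → ℂ) :
    conj (∫ x in (0:ℝ)..1, u x * conj (v x)) = ∫ x in (0:ℝ)..1, v x * conj (u x) := by
  rw [conj_intervalIntegral']
  refine intervalIntegral.integral_congr fun x _ => ?_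
  simp only [map_mul, Complex.conj_conj]
  ring

/-- The primitive has derivative `h(x)` at interior points (plumbing). [folklore] -/
private theorem hasDerivAt_primitive_unit' {h : ℝ → ℂ} (hh : ContinuousOn h (Icc 0 1)) {x : ℝ}
    (hx : x ∈ Ioo (0:ℝ) 1) : HasDerivAt (fun y => ∫ t in (0:ℝ)..y, h t) (h x) x := by
  have hint : IntervalIntegrable h volume 0 x :=
    (hh.mono (Icc_subset_Icc_right hx.2.le)).intervalIntegrable_of_Icc hx.1.le
  have hmeas : StronglyMeasurableAtFilter h (nhds x) volume :=
    ContinuousOn.stronglyMeasurableAtFilter isOpen_Ioo (hh.mono Ioo_subset_Icc_self) x hx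
  have hcont : ContinuousAt h x := hh.continuousAt (Icc_mem_nhds hx.1 hx.2)
  exact intervalIntegral.integral_hasDerivAt_right hint hmeas hcont

/-- **Integration by parts of the two primitive terms**: for `u, v` continuous on `[0,1]`,
`∫₀¹ u·conj(S_v) + ∫₀¹ S_u·conj(v) = (∫₀¹ u)·conj(∫₀¹ v)` (`(S_u·conj S_v)′ = u·conj S_v + S_u·conj v`).
[cite: Zhang2022LandauSiegel, §18 (18.1)] -/
theorem integral_mul_conj_primitive_add {u v : ℝ → ℂ} (hu : ContinuousOn u (Icc 0 1))
    (hv : ContinuousOn v (Icc 0 1)) :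
    (∫ x in (0:ℝ)..1, u x * conj (∫ t in (0:ℝ)..x, v t))
      + (∫ x in (0:ℝ)..1, (∫ t in (0:ℝ)..x, u t) * conj (v x))
      = (∫ t in (0:ℝ)..1, u t) * conj (∫ t in (0:ℝ)..1, v t) := by
  have hSu : ContinuousOn (fun x => ∫ t in (0:ℝ)..x, u t) (Icc 0 1) := continuousOn_primitive_unit hu
  have hSv : ContinuousOn (fun x => ∫ t in (0:ℝ)..x, v t) (Icc 0 1) := continuousOn_primitive_unit hv
  have hΦc : ContinuousOn (fun x => (∫ t in (0:ℝ)..x, u t) * conj (∫ t in (0:ℝ)..x, v t)) (Icc 0 1) :=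
    hSu.mul (continuousOn_conj_comp hSv)
  have hΦd : ∀ x ∈ Ioo (0:ℝ) 1, HasDerivAt (fun x => (∫ t in (0:ℝ)..x, u t) * conj (∫ t in (0:ℝ)..x, v t))
      (u x * conj (∫ t in (0:ℝ)..x, v t) + (∫ t in (0:ℝ)..x, u t) * conj (v x)) x := by
    intro x hx
    exact (hasDerivAt_primitive_unit' hu hx).mul (hasDerivAt_conj_comp (hasDerivAt_primitive_unit' hv hx))
  have hi1 : IntervalIntegrable (fun x => u x * conj (∫ t in (0:ℝ)..x, v t)) volume 0 1 :=
    (hu.mul (continuousOn_conj_comp hSv)).intervalIntegrable_of_Icc zero_le_one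
  have hi2 : IntervalIntegrable (fun x => (∫ t in (0:ℝ)..x, u t) * conj (v x)) volume 0 1 :=
    (hSu.mul (continuousOn_conj_comp hv)).intervalIntegrable_of_Icc zero_le_one
  have key := intervalIntegral.integral_eq_sub_of_hasDerivAt_of_le zero_le_one hΦc hΦd (hi1.add hi2)
  rw [intervalIntegral.integral_add hi1 hi2] at key
  simp only [intervalIntegral.integral_same, map_zero, mul_zero, sub_zero] at key
  exact key

/-! ### The identity -/

/-- **The cross slot splits as boundary block + window form**: for `u, v` continuous on `[0,1]` with
`u(1) = 0`, `v(0) = 0`,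
`P(u,v) = F₀(u(0), conj v(1); ∫u, conj ∫v) + W(u,v)`.
(The six terms of `s(u,v)` and of `conj s(v,u)`, halved; the two primitive terms combine through
`integral_mul_conj_primitive_add` into `−48π²i⟨u,S_v⟩ + 24π²i(∫u)conj(∫v)`.)
[cite: Zhang2022LandauSiegel, §18 (18.1); §12 (12.12)–(12.17)] -/
theorem mainTermFormPolar_eq_F0gen_add_windowForm {u u' v v' : ℝ → ℂ} (hu : ContinuousOn u (Icc 0 1))
    (hv : ContinuousOn v (Icc 0 1)) (hu1 : u 1 = 0) (hv0 : v 0 = 0) :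
    mainTermFormPolar u u' v v'
      = F0gen (u 0) (conj (v 1)) (∫ t in (0:ℝ)..1, u t) (conj (∫ t in (0:ℝ)..1, v t))
        + windowForm u u' v v' := by
  have ibp := integral_mul_conj_primitive_add hu hv
  unfold mainTermFormPolar mainTermFormSesq F0gen windowForm
  rw [hu1, hv0]
  -- rewrite the conjugated sesquilinear terms of `s(v,u)`
  have c1 : conj (∫ x in (0:ℝ)..1, v' x * conj (u' x)) = ∫ x in (0:ℝ)..1, u' x * conj (v' x) :=
    conj_integral_mul_conj' v' u'
  have c2 : conj (∫ x in (0:ℝ)..1, v' x * conj (u x)) = ∫ x in (0:ℝ)..1, u x * conj (v' x) :=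
    conj_integral_mul_conj' v' u
  have c3 : conj (∫ x in (0:ℝ)..1, v x * conj (u x)) = ∫ x in (0:ℝ)..1, u x * conj (v x) :=
    conj_integral_mul_conj' v u
  have c4 : conj (∫ x in (0:ℝ)..1, v x * conj (∫ t in (0:ℝ)..x, u t))
      = ∫ x in (0:ℝ)..1, (∫ t in (0:ℝ)..x, u t) * conj (v x) := by
    rw [conj_intervalIntegral']
    refine intervalIntegral.integral_congr fun x _ => ?_
    simp only [map_mul, Complex.conj_conj]
    ring
  simp only [map_add, map_sub, map_mul, map_zero, Complex.conj_ofReal, Complex.conj_I, Complex.conj_conj,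
    c1, c2, c3, c4, add_zero, zero_add, mul_zero]
  push_cast
  linear_combination ((24 : ℂ) * π ^ 2 * I) * ibp

/-- **The cross slot against a reflected profile**: for `u, g` continuous on `[0,1]` with `u(1) = 0 = g(1)`,
`P(u, R̃g) = F₀(u(0), g(0); ∫u, ∫g) + W(u, R̃g)` (`conj R̃g(1) = g(0)`, `conj ∫R̃g = ∫g`).
[cite: Zhang2022LandauSiegel, §18 (18.1); §12 (12.6)–(12.8)] -/
theorem mainTermFormPolar_refl_eq {u u' g g' : ℝ → ℂ} (hu : ContinuousOn u (Icc 0 1))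
    (hg : ContinuousOn g (Icc 0 1)) (hu1 : u 1 = 0) (hg1 : g 1 = 0) :
    mainTermFormPolar u u' (reflProfile g) (reflDeriv g')
      = F0gen (u 0) (g 0) (∫ t in (0:ℝ)..1, u t) (∫ t in (0:ℝ)..1, g t)
        + windowForm u u' (reflProfile g) (reflDeriv g') := by
  have hv : ContinuousOn (reflProfile g) (Icc 0 1) := by
    unfold reflProfile
    refine continuousOn_conj_comp (hg.comp (by fun_prop) ?_)
    intro y hy
    exact ⟨by linarith [hy.2], by linarith [hy.1]⟩
  have hv0 : reflProfile g 0 = 0 := by rw [reflProfile_zero, hg1, map_zero]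
  rw [mainTermFormPolar_eq_F0gen_add_windowForm hu hv hu1 hv0, reflProfile_one, Complex.conj_conj,
    integral_reflProfile_one, Complex.conj_conj]

end Repair

end Literature.NumberTheory.LFunctions.Zhang2022
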